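import Mathlib
import HarnessLib

/-!
# Rotational quotients of smooth 4-manifolds (`|N⁴/G|` with its canonical smooth structure)

Topic `Topology/FourManifolds`; namespace `Literature.Topology.FourManifolds`. A DEFINITION file
(requested notion `RotationalQuotientFour`, definition request D1 of route
`SmoothPoincare4/QuotientSpheres`, wanted by item `stmt-SmoothPoincare4-8190` = crux
`CyclicQuotient`, to state the card's crux C2 "QUOT for cyclic-with-exceptional-points, dihedral
and polyhedral rotation groups").

## The mathematics

Let a finite group `G` act smoothly on a smooth `4`-manifold `N` (the standard `S⁴` in the
route). At a point `x` the isotropy group `G_x` acts linearly on `T_x N` by the differentials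
`d_x g`; its image `ρ(G_x)` (a finite subgroup of `GL(T_x N)`, orthogonal for any invariant
metric) is the *local group* of the orbifold `N/G` at `[x]`. Following Mikhaîlova and Lange, a
**rotation** is a linear transformation whose fixed-point subspace has codimension two, and a
**rotation group** is a finite linear group generated by rotations (Lange 2019, §1: "finite groups
generated by rotations, i.e. by orthogonal transformations whose fixed-point subspace has
codimension two. We call such a group a rotation group"; arXiv v1 Def. 2.1 says
"pseudoreflection (group)" for the same notions). Lange's Theorem A (with `n ≤ 4`, so no Poincaré
factors) says that `ℝ⁴/Γ` is a topological manifold without boundary iff `Γ` is a rotation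
group, and Corollary B that `S⁴/Γ ≅ S⁴` for `Γ < O(5)` finite iff `Γ` is a rotation group; so the
orbit space `|N/G|` is a topological `4`-manifold exactly when every local group is a rotation
group (Lange2019, Theorem A, Corollary B). Lange's stratification (§2.1): the
codimension-`i` stratum `Σᵢ` consists of the points `x` with `codim Fix(ρ(G_x)) = i`; for
rotation groups in dimension `4` only `i ∈ {0, 2, 3, 4}` occur (`i = 1` would need a reflection):
`Σ₀` = regular points (`ρ(G_x) = 1`), `Σ₂` = `ρ(G_x)` cyclic generated by one rotation about the
plane `Fix` (surfaces), `Σ₃` = `ρ(G_x)` a non-cyclic finite subgroup of `SO(3)` acting on the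
`3`-space normal to the fixed line (dihedral, tetrahedral, octahedral, icosahedral; curves),
`Σ₄` = `Fix = 0` (isolated points; e.g. `ℤ/p × ℤ/q` rotating the two planes of `ℂ ⊕ ℂ`).

The **canonical smooth structure** on `M = |N/G|` making the orbit map `q : N → M` smooth:
on `Σ₀` the covering charts; along `Σ₂` the branched charts `(z, w) ↦ (z, wⁿ)` of
Hambleton–Hausmann (HambletonHausmann2010, App. §7, Def. 7.1 and Lemma 7.3: existence from an
invariant metric via the normal exponential map of the fixed surface, uniqueness up to
diffeomorphism on closed manifolds, NOT functorial — Rem. 7.5); at a point `x` of `Σ₃ ∪ Σ₄` the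
cone-off smoothing: choose a chart about `x` in which `G_x` acts by linear isometries
(differentiable slice theorem, Bredon1972 VI.2); the LINK — the quotient `|S³/ρ(G_x)|` of a small
round sphere about `x`, resp., for `x ∈ Σ₃`, the quotient `|S²/ρ(G_x)|` of the unit sphere of the
`3`-space normal to the fixed line — is a topological sphere (Lange2019, Corollary B), carries
the smooth structure coming from its own lower-dimensional strata, hence is diffeomorphic to the
round sphere (smooth structures on `S²`, `S³` are unique; cf. the tree fact
`nonempty_diffeomorph_sphere_three`); one gives the punctured neighbourhood of `q x` the product
structure link `× (0, ε)` (for `Σ₃`: `×` the fixed line as well) and closes it up by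
identifying the cone on the link with a round ball, cone levels going to round spheres (with a
radial reparametrisation flat at the apex, so that `q` stays smooth). The result is well defined
up to diffeomorphism because every diffeomorphism of `S³` or `S²` is isotopic to an isometry
(Cerf, `Γ₄ = 0`, tree fact `cerf_twistedSphere_four`; Smale).

## What is defined (relational form, as for `IsBranchedDoubleQuotient`, `IsRealProjectiveSpace`)

* `fixedSubspace A`, `IsRotation A` (codimension of `Fix A` is `2`), `IsRotationGroup Γ` (finite,
  generated by its rotations) — Lange's linear notions, for any real vector space.
* `isotropyDifferential I G g x = d_x (g • ·)`, `tangentFixedSubspace I G x = ⋂_{g ∈ G_x} Fix d_x g`,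
  `singularCodim I G x = codim` of it (Lange's stratum index), `IsRotationalAction I G N`
  (finite `G`, each `g • ·` is `C^∞`, and every `G_x` is generated by its elements acting on
  `T_x N` as rotations together with those acting trivially — i.e. the local group `ρ(G_x)` is a
  rotation group) — for any real model with corners `I`.
* `rotationFoldModel n : ℝ⁴ → ℝ⁴`, `(v₀, v₁, v₂, v₃) ↦ (v₀, v₁, Re ζⁿ, Im ζⁿ)`, `ζ = v₂ + i v₃` —
  literally the local model inlined in the items of route `QuotientSpheres`.
* `axisNormalPart v = (0, v₁, v₂, v₃)`.
* `IsRotationalBranchedQuotient G q` for `q : N → M` between charted spaces modelled on `ℝ⁴`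
  with a `G`-action on `N`: rotational action; `q` is a topological quotient map with fibres the
  `G`-orbits; `q` is `C^∞`; strata only of codimension `0, 2, 3, 4`; `q` is a local diffeomorphism
  at `Σ₀`; HH fold charts at `Σ₂` (`ψ ∘ q = rotationFoldModel n ∘ φ`, `n ≥ 2`, charts of the `C^∞`
  maximal atlases); at `Σ₃` a chart `φ` centred at `x` in which `G_x` acts by linear isometries
  and a chart `ψ` of `M` with `q(φ.source) = ψ.source` in which `q` preserves the axial coordinate
  and maps the normal round `2`-spheres of radius `r` onto those of radius `σ r` (`σ` strictly
  increasing, `σ 0 = 0`); at `Σ₄` the same with the round `3`-spheres about `x`: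
  `‖ψ (q y)‖ = σ ‖φ y‖`.
* `RotationalQuotientFour G N` — the bundled form (b): a Hausdorff second-countable `C^∞`
  `4`-manifold `carrier` with `proj : N → carrier` satisfying `IsRotationalBranchedQuotient`
  ("the underlying smooth `4`-manifold `|N/G|`").

API proved here: membership/unfolding lemmas, `isRotation_iff_finrank`, the identity is not a
rotation and has full fixed subspace, `singularCodim ≤ finrank`, `rotationFoldModel 1 = id`,
smoothness of the fold model, and for `h : IsRotationalBranchedQuotient G q`: `q` is continuous,
surjective, constant on orbits, an open map... (see the `IsRotationalBranchedQuotient` namespace),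
and the cone charts are centred (`ψ (q x) = 0`).

## Design notes

* Why `G_x = closure {g ∈ G_x | d_x g is a rotation ∨ d_x g = 1}`: this says exactly that the
  local group `ρ(G_x) ≤ GL(T_x N)` is generated by the rotations it contains, without having to
  build `ρ` as a homomorphism (for an effective smooth action of a finite group on a connected
  manifold `ρ` is faithful on `G_x` — local linearisability, cf. Bredon VI.2 — and the second
  disjunct only adds `g = 1`).
* Why the radial profile `σ` and global smoothness of `q`: with straight cones (`σ = id`) the
  orbit map is not differentiable at the cone points; the canonical structure is only defined up
  to diffeomorphism anyway (HH Lemma 7.3 (2), Rem. 7.5), and any two `σ` give diffeomorphic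
  results. Requiring `q` smooth keeps `C^∞(M) ⊆ C^∞(N)^G`, as in HH Def. 7.1.
* Why no lower-dimensional recursion at the cone points: the smooth structure of `M` near a cone
  point off the point itself is constrained by the clauses at the neighbouring points of `Σ₀`,
  `Σ₂`, `Σ₃`; the cone clause only adds how the levels close up at the apex.
* Effectiveness of the action, `IsManifold` for `N` and `M`, compactness, orientations are NOT
  fields (consumers add them, as for `IsBranchedDoubleQuotient`); free actions (all points in
  `Σ₀`, `q` a smooth covering, e.g. `S⁴ → ℝP⁴`) ARE rotational quotients — statements wanting a
  fixed point say so.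
* Deliberately not here (theorems about the predicate, i.e. the route's business): EXISTENCE of
  `(M, q)` for every rotational action (HH 7.3 (1) generalised + cone-off), UNIQUENESS up to
  diffeomorphism (HH 7.3 (2), Cerf), Lange's Theorem A / Corollary B themselves, Armstrong's
  `π₁(|N/G|)`.

## Non-vacuity

The trivial group acting on any `N` with `q = id : N → N` satisfies every clause (all points are
regular: `d_x 1 = id`, `Fix = ⊤`, codimension `0`; checked in the seat's scratch file, see
NOTES.md). The motivating instances — the linear rotation of order `n` of `S⁴ ⊂ ℝ³ ⊕ ℂ` with
`q (x′, w) = (x′, wⁿ)/‖(x′, wⁿ)‖` (route item `LinearQuotientModel`), `ℤ/p × ℤ/q` rotating the two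
planes of `S⁴ ⊂ ℝ ⊕ ℂ ⊕ ℂ` (two cone points `(±1, 0, 0)`, fold surfaces `{z = 0}`, `{w = 0}`), a
polyhedral group `Γ < SO(3)` acting on `S⁴ ⊂ ℝ² ⊕ ℝ³` (a circle of `Σ₃`-points) — satisfy it with
the polar/product charts described above; these analytic verifications are not formalised here.

## Mathlib / tree search

Mathlib: `LinearMap.eqLocus`, `Module.finrank`, quotient modules, `Subgroup.closure`,
`MulAction.stabilizer/orbit`, `mfderiv`, `ContMDiff`, `IsLocalDiffeomorphAt`,
`IsManifold.maximalAtlas`, `Topology.IsQuotientMap`, `EuclideanSpace`; no orbifolds, no branched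
coverings, no rotation/pseudoreflection groups (`lean search 'IsRotation|BranchedCover|
isotropyRep'`: only unrelated `IsRotationInvariant` predicates in physics files). Tree:
`IsBranchedDoubleQuotient` (`BranchedDoubleQuotient.lean`, conjugation quotients, model
`(Re z, Re w, (Im z)² − (Im w)², 2 Im z Im w)`) and the cyclic clause inlined in
`Summits/SmoothPoincare4/SmoothPoincare4/Theses/QuotientSpheres.lean` (whose fold formula
`rotationFoldModel` reproduces verbatim); neither covers non-cyclic isotropy.

## References

* C. Lange, *When is the underlying space of an orbifold a manifold?*, Trans. Amer. Math. Soc. 372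
  (2019) 2799–2828 = arXiv:1307.4875 (v3), §1 (rotation, rotation group), Theorem A, Corollary B,
  §2.1 (strata `Σᵢ`). [Lange2019]
* I. Hambleton, J.-C. Hausmann, *Conjugation spaces and 4-manifolds*, Math. Z. 269 (2011) 521–541 =
  arXiv:0906.5057, Appendix §7, Def. 7.1, Lemma 7.3, Rem. 7.5. [HambletonHausmann2010]
* G. E. Bredon, *Introduction to compact transformation groups*, Academic Press (1972), VI.2
  (linear slices / equivariant tubular neighbourhoods). [Bredon1972]
-/

noncomputable section

open scoped Manifold ContDiff
open Set Function Module

namespace Literature.Topology.FourManifolds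

/-! ### Rotations and rotation groups (Mikhaîlova, Lange) -/

section LinearAlgebra

variable {E : Type*} [AddCommGroup E] [Module ℝ E]

/-- The fixed-point subspace `Fix A = {v | A v = v}` of a linear endomorphism `A` (Mathlib's
`LinearMap.eqLocus A id`). [folklore] -/
def fixedSubspace (A : E →ₗ[ℝ] E) : Submodule ℝ E :=
  LinearMap.eqLocus A LinearMap.id

/-- `v ∈ Fix A ↔ A v = v`. [folklore] -/
@[simp] theorem mem_fixedSubspace_iff (A : E →ₗ[ℝ] E) (v : E) :
    v ∈ fixedSubspace A ↔ A v = v :=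
  Iff.rfl

/-- The identity fixes everything: `Fix id = ⊤`. [folklore] -/
@[simp] theorem fixedSubspace_id : fixedSubspace (LinearMap.id : E →ₗ[ℝ] E) = ⊤ :=
  LinearMap.eqLocus_same _

/-- **Rotation** (Mikhaîlova; Lange 2019, §1; "pseudoreflection" in arXiv:1307.4875v1, Def. 2.1):
a linear transformation whose fixed-point subspace has codimension two,
`dim (E ⧸ Fix A) = 2`. For an orthogonal `A` this means: `A` is a non-trivial rotation of the
plane `(Fix A)⊥` and the identity on `Fix A`; in particular `det A = 1`.
[cite: Lange2019, §1 Introduction (rotation: fixed-point subspace of codimension two)] -/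
def IsRotation (A : E →ₗ[ℝ] E) : Prop :=
  finrank ℝ (E ⧸ fixedSubspace A) = 2

/-- Unfolding `IsRotation`. [folklore] -/
theorem isRotation_iff (A : E →ₗ[ℝ] E) :
    IsRotation A ↔ finrank ℝ (E ⧸ fixedSubspace A) = 2 :=
  Iff.rfl

/-- In finite dimension, `A` is a rotation iff `dim Fix A + 2 = dim E`. [folklore] -/
theorem isRotation_iff_finrank [FiniteDimensional ℝ E] (A : E →ₗ[ℝ] E) :
    IsRotation A ↔ finrank ℝ (fixedSubspace A) + 2 = finrank ℝ E := by
  rw [isRotation_iff]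
  have h := (fixedSubspace A).finrank_quotient_add_finrank
  omega

/-- The identity is not a rotation (its fixed subspace has codimension `0`). [folklore] -/
theorem not_isRotation_id : ¬ IsRotation (LinearMap.id : E →ₗ[ℝ] E) := by
  rw [isRotation_iff, fixedSubspace_id]
  have h0 : finrank ℝ (E ⧸ (⊤ : Submodule ℝ E)) = 0 := finrank_zero_of_subsingleton
  omega

/-- **Rotation group** (Mikhaîlova; Lange 2019, §1: "finite groups generated by rotations … We
call such a group a rotation group"; "pseudoreflection group", arXiv:1307.4875v1 Def. 2.1): a
finite group `Γ` of linear automorphisms generated by the rotations it contains. Lange takes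
`Γ < O(n)`; a finite subgroup of `GL(E)` preserves an inner product (averaging), and `IsRotation`
is a conjugation invariant, so nothing is lost by allowing `GL(E)`. Examples (loc. cit.):
orientation-preserving subgroups of real reflection groups, unitary reflection groups viewed as
real groups. [cite: Lange2019, §1 Introduction (rotation group)] -/
def IsRotationGroup (Γ : Subgroup (E ≃ₗ[ℝ] E)) : Prop :=
  Finite Γ ∧ Subgroup.closure {g : E ≃ₗ[ℝ] E | g ∈ Γ ∧ IsRotation (g : E →ₗ[ℝ] E)} = Γ

/-- Unfolding `IsRotationGroup`. [folklore] -/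
theorem isRotationGroup_iff (Γ : Subgroup (E ≃ₗ[ℝ] E)) :
    IsRotationGroup Γ ↔
      Finite Γ ∧ Subgroup.closure {g : E ≃ₗ[ℝ] E | g ∈ Γ ∧ IsRotation (g : E →ₗ[ℝ] E)} = Γ :=
  Iff.rfl

/-- The trivial group is a rotation group (generated by the empty set of rotations).
[folklore] -/
theorem isRotationGroup_bot : IsRotationGroup (⊥ : Subgroup (E ≃ₗ[ℝ] E)) := by
  refine ⟨inferInstance, ?_⟩
  rw [Subgroup.closure_eq_bot_iff]
  rintro g ⟨hg, -⟩
  exact Set.mem_singleton_iff.2 (Subgroup.mem_bot.1 hg)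

end LinearAlgebra

/-! ### The linear isotropy of a smooth action and Lange's strata -/

section Action

variable {E : Type*} [NormedAddCommGroup E] [NormedSpace ℝ E] {H : Type*} [TopologicalSpace H]
  (I : ModelWithCorners ℝ E H) (G : Type*) [Group G]
  {N : Type*} [TopologicalSpace N] [ChartedSpace H N] [MulAction G N]

/-- The **isotropy differential** `d_x g : T_x N → T_{g x} N` of the action of `g`, read in the
model space `E` (Mathlib identifies every tangent space with `E`); for `g ∈ G_x` this is the
linear isotropy action of `g` on `T_x N`, and `g ↦ d_x g` is the local (isotropy)
representation `ρ : G_x → GL(T_x N)` of the orbifold `N/G` at `[x]` (Lange 2019, §2.1; Bredon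
VI.2). [folklore] -/
def isotropyDifferential (g : G) (x : N) : E →L[ℝ] E :=
  mfderiv I I (fun y : N => g • y) x

/-- Unfolding `isotropyDifferential`. [folklore] -/
theorem isotropyDifferential_def (g : G) (x : N) :
    isotropyDifferential I G g x = mfderiv I I (fun y : N => g • y) x :=
  rfl

/-- The identity element acts with differential the identity: `d_x 1 = id`. [folklore] -/
@[simp] theorem isotropyDifferential_one (x : N) :
    isotropyDifferential I G (1 : G) x = ContinuousLinearMap.id ℝ E := by
  have h : (fun y : N => (1 : G) • y) = id := funext fun y => one_smul G y
  rw [isotropyDifferential_def, h, mfderiv_id]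
  rfl

/-- The **common fixed subspace of the linear isotropy group** at `x`:
`Fix(ρ(G_x)) = ⋂_{g ∈ G_x} Fix(d_x g) ⊆ T_x N = E` (Lange 2019, §2.1). [cite: Lange2019, §2.1 (codimension i stratum: codim Fix(G_x) = i)] -/
def tangentFixedSubspace (x : N) : Submodule ℝ E :=
  ⨅ g : MulAction.stabilizer G x, fixedSubspace (isotropyDifferential I G (g : G) x : E →ₗ[ℝ] E)

/-- `v` is in the common fixed subspace iff every isotropy differential fixes it. [folklore] -/
theorem mem_tangentFixedSubspace_iff (x : N) (v : E) :
    v ∈ tangentFixedSubspace I G x ↔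
      ∀ g : G, g • x = x → isotropyDifferential I G g x v = v := by
  simp only [tangentFixedSubspace, Submodule.mem_iInf, mem_fixedSubspace_iff,
    ContinuousLinearMap.coe_coe, Subtype.forall, MulAction.mem_stabilizer_iff]

/-- **Lange's stratum index**: the codimension of the common fixed subspace of the linear
isotropy group at `x`; `x` lies on the codimension-`i` stratum `Σᵢ` of `N/G` iff
`singularCodim I G x = i`, and `Σ₀` is the regular stratum (Lange 2019, §2.1: "the codimension
`i` stratum `Σᵢ` consists of all points `x` with `codim Fix(G_x) = i`").
[cite: Lange2019, §2.1 (strata Σ_i)] -/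
def singularCodim (x : N) : ℕ :=
  finrank ℝ (E ⧸ tangentFixedSubspace I G x)

/-- Unfolding `singularCodim`. [folklore] -/
theorem singularCodim_def (x : N) :
    singularCodim I G x = finrank ℝ (E ⧸ tangentFixedSubspace I G x) :=
  rfl

/-- The stratum index is at most the dimension: `codim Fix ≤ dim E`. [folklore] -/
theorem singularCodim_le_finrank [FiniteDimensional ℝ E] (x : N) :
    singularCodim I G x ≤ finrank ℝ E := by
  rw [singularCodim_def]
  exact Submodule.finrank_quotient_le _

/-- A point with trivial isotropy group is regular: `G_x = 1 → singularCodim x = 0`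
(`Fix(1) = T_x N`). [folklore] -/
theorem singularCodim_eq_zero_of_stabilizer_eq_bot {x : N}
    (hx : MulAction.stabilizer G x = ⊥) : singularCodim I G x = 0 := by
  have htop : tangentFixedSubspace I G x = ⊤ := by
    rw [eq_top_iff]
    intro v _
    rw [mem_tangentFixedSubspace_iff]
    intro g hg
    have hg1 : g = 1 := by
      have : g ∈ MulAction.stabilizer G x := hg
      rwa [hx, Subgroup.mem_bot] at this
    subst hg1
    simp
  rw [singularCodim_def, htop]
  exact finrank_zero_of_subsingleton

variable (N) in
/-- **Rotational action** (the hypothesis of Lange's manifold criterion, as a predicate on a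
smooth action; request (a)): `G` is finite, every `g` acts by a `C^∞` map (hence by a
diffeomorphism, with inverse `g⁻¹`), and at every point `x` the isotropy group `G_x` is generated
by its elements acting on `T_x N` as ROTATIONS together with those acting trivially on `T_x N` —
equivalently, the local group `ρ(G_x) = {d_x g | g ∈ G_x} ≤ GL(T_x N)` is a rotation group
(`IsRotationGroup`; for an effective smooth action of a finite group on a connected manifold
`ρ` is faithful on `G_x` — a standard consequence of the local linearisability of the action,
cf. Bredon VI.2 — so then simply "`G_x` is generated by elements acting as rotations"). By Lange's
Theorem A (`n = 4`: no Poincaré factors) this is exactly the condition for `|N/G|` to be a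
topological `4`-manifold without boundary when `dim N = 4`. Effectiveness is not required.
[cite: Lange2019, Theorem A (n ≤ 4: local groups are rotation groups)] -/
structure IsRotationalAction : Prop where
  /-- `G` is a finite group. -/
  finite : Finite G
  /-- Each group element acts by a `C^∞` map. -/
  contMDiff_smul : ∀ g : G, ContMDiff I I ∞ (fun y : N => g • y)
  /-- Every isotropy group is generated by the elements acting on the tangent space as rotations
  together with those acting trivially there: the local group `ρ(G_x)` is a rotation group. -/
  stabilizer_eq_closure : ∀ x : N, MulAction.stabilizer G x =
    Subgroup.closure {g : G | g • x = x ∧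
      (IsRotation (isotropyDifferential I G g x : E →ₗ[ℝ] E) ∨
        isotropyDifferential I G g x = ContinuousLinearMap.id ℝ E)}

end Action

/-! ### The local models in dimension four -/

/-- **The fold (branched-cover) model of order `n`** on `ℝ⁴ = ℝ² × ℂ`:
`(v₀, v₁, v₂, v₃) ↦ (v₀, v₁, Re ζⁿ, Im ζⁿ)` with `ζ = v₂ + i v₃`, i.e. `(z, w) ↦ (z, wⁿ)` — the
identity along the fixed plane and the `n`-th power on the normal plane; Hambleton–Hausmann's
model `(a, z) ↦ (a, z²)` for `n = 2` (App., (7.2) and Def. 7.1), and verbatim the formula inlined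
in the items of route `QuotientSpheres`. [cite: HambletonHausmann2010, Appendix §7, eq. (7.2) / Definition 7.1 (local model z ↦ z^2)] -/
def rotationFoldModel (n : ℕ) (v : EuclideanSpace ℝ (Fin 4)) : EuclideanSpace ℝ (Fin 4) :=
  WithLp.toLp 2 fun j : Fin 4 =>
    if j = 2 then (((v 2 : ℂ) + (v 3 : ℂ) * Complex.I) ^ n).re
    else if j = 3 then (((v 2 : ℂ) + (v 3 : ℂ) * Complex.I) ^ n).im
    else v j

/-- The coordinates of the fold model (unfolding lemma). [folklore] -/
theorem rotationFoldModel_apply (n : ℕ) (v : EuclideanSpace ℝ (Fin 4)) (j : Fin 4) :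
    rotationFoldModel n v j =
      if j = 2 then (((v 2 : ℂ) + (v 3 : ℂ) * Complex.I) ^ n).re
      else if j = 3 then (((v 2 : ℂ) + (v 3 : ℂ) * Complex.I) ^ n).im
      else v j :=
  rfl

/-- The fold model of order `1` is the identity. [folklore] -/
@[simp] theorem rotationFoldModel_one : rotationFoldModel 1 = id := by
  funext v
  ext j
  rw [rotationFoldModel_apply, pow_one]
  fin_cases j <;> simp

/-- The fold model fixes the first two coordinates (the branch plane directions). [folklore] -/
theorem rotationFoldModel_apply_of_lt (n : ℕ) (v : EuclideanSpace ℝ (Fin 4)) {j : Fin 4}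
    (hj : (j : ℕ) < 2) : rotationFoldModel n v j = v j := by
  rw [rotationFoldModel_apply]
  have h2 : j ≠ 2 := fun h => by subst h; simp at hj
  have h3 : j ≠ 3 := fun h => by subst h; simp at hj
  simp [h2, h3]

/-- **The fold model is `C^∞`** (its coordinates are polynomials). [folklore] -/
theorem contDiff_rotationFoldModel (n : ℕ) : ContDiff ℝ ∞ (rotationFoldModel n) := by
  rw [contDiff_euclidean]
  have hc : ∀ i : Fin 4, ContDiff ℝ ∞ fun v : EuclideanSpace ℝ (Fin 4) => v i := fun i =>
    (contDiff_euclidean.1 contDiff_id) i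
  have h2 : ContDiff ℝ ∞ fun v : EuclideanSpace ℝ (Fin 4) => ((v 2 : ℝ) : ℂ) :=
    Complex.ofRealCLM.contDiff.comp (hc 2)
  have h3 : ContDiff ℝ ∞ fun v : EuclideanSpace ℝ (Fin 4) => ((v 3 : ℝ) : ℂ) :=
    Complex.ofRealCLM.contDiff.comp (hc 3)
  have hζ : ContDiff ℝ ∞ fun v : EuclideanSpace ℝ (Fin 4) =>
      ((v 2 : ℂ) + (v 3 : ℂ) * Complex.I) :=
    h2.add (h3.mul contDiff_const)
  intro j
  by_cases h2 : j = 2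
  · subst h2
    simpa [rotationFoldModel_apply, Function.comp_def] using
      Complex.reCLM.contDiff.comp (hζ.pow n)
  by_cases h3 : j = 3
  · subst h3
    simpa [rotationFoldModel_apply, Function.comp_def] using
      Complex.imCLM.contDiff.comp (hζ.pow n)
  simpa [rotationFoldModel_apply, h2, h3] using hc j

/-- The component of `v ∈ ℝ⁴` normal to the first coordinate axis: `(0, v₁, v₂, v₃)` (used at
points of the codimension-`3` stratum, where the axis is the fixed line). [folklore] -/
def axisNormalPart (v : EuclideanSpace ℝ (Fin 4)) : EuclideanSpace ℝ (Fin 4) :=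
  WithLp.toLp 2 fun j : Fin 4 => if j = 0 then 0 else v j

/-- The coordinates of `axisNormalPart` (unfolding lemma). [folklore] -/
theorem axisNormalPart_apply (v : EuclideanSpace ℝ (Fin 4)) (j : Fin 4) :
    axisNormalPart v j = if j = 0 then 0 else v j :=
  rfl

/-- `axisNormalPart 0 = 0`. [folklore] -/
@[simp] theorem axisNormalPart_zero : axisNormalPart 0 = 0 := by
  ext j
  simp [axisNormalPart_apply]

/-! ### Rotational branched quotients of `4`-manifolds -/

section Quotient

variable (G : Type*) [Group G]
  {N : Type*} [TopologicalSpace N] [ChartedSpace (EuclideanSpace ℝ (Fin 4)) N] [MulAction G N]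
  {M : Type*} [TopologicalSpace M] [ChartedSpace (EuclideanSpace ℝ (Fin 4)) M]

/-- **`q : N → M` exhibits the smooth `4`-manifold `M` as the rotational (branched) quotient
`|N/G|` with its canonical smooth structure** (request (c); generalises the cyclic clause
inlined in route `QuotientSpheres` from semifree cyclic actions to all actions with
rotation-group isotropy). Fields: the action is rotational (`IsRotationalAction`); `q` is a
topological quotient map whose fibres are exactly the `G`-orbits; `q` is `C^∞`; every point lies
on a stratum of codimension `0, 2, 3` or `4`; and, stratum by stratum (Lange's `Σᵢ`,
`singularCodim`): on `Σ₀` `q` is a local diffeomorphism (a smooth covering of the regular part);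
at `x ∈ Σ₂` there are charts `φ` of `N` at `x` and `ψ` of `M` (members of the `C^∞` maximal
atlases) with `ψ ∘ q = rotationFoldModel n ∘ φ` on `φ.source`, `n ≥ 2` — Hambleton–Hausmann's
branched covering charts `(z, w) ↦ (z, wⁿ)` (Def. 7.1, Lemma 7.3); at `x ∈ Σ₃` there are a chart
`φ` centred at `x` whose source is `G_x`-invariant and in which `G_x` acts by linear isometries,
a chart `ψ` of `M` with `q(φ.source) = ψ.source`, and a strictly increasing radial profile `σ`
with `σ 0 = 0`, such that `q` preserves the axial coordinate and maps the round normal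
`2`-sphere of radius `r` about the axis onto the one of radius `σ r` (the cone on the smoothed
link `|S²/ρ(G_x)| ≅ S²`, times the fixed line); at `x ∈ Σ₄` the same with the round `3`-spheres
about `x`: `‖ψ (q y)‖ = σ ‖φ y‖` (the cone on the smoothed link `|S³/ρ(G_x)| ≅ S³`, identified
with a round ball — well defined up to diffeomorphism by Cerf's `Γ₄ = 0`). For a semifree
`ℤ/n`-action with fixed surface (all singular points in `Σ₂`) the last two clauses are vacuous
and this is the notion inlined in the items of route `QuotientSpheres` (there with charts given
as injective local diffeomorphisms on open sets rather than members of the maximal atlas, and for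
compact `N` and Hausdorff `M` the quotient-map clause follows from continuity and surjectivity).
The manifold axioms for `N`, `M`, effectiveness, compactness are not fields.
[cite: HambletonHausmann2010, Definition 7.1 and Lemma 7.3 (quotient smooth structure, branched charts)] -/
structure IsRotationalBranchedQuotient (q : N → M) : Prop where
  /-- The action of `G` on `N` is a smooth action of a finite group with rotation-group
  isotropy. -/
  isRotationalAction : IsRotationalAction (𝓡 4) G N
  /-- `q` is a topological quotient map (`M` carries the quotient topology of `N/G`). -/
  isQuotientMap : Topology.IsQuotientMap q
  /-- The fibres of `q` are exactly the `G`-orbits. -/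
  apply_eq_iff : ∀ x y : N, q x = q y ↔ y ∈ MulAction.orbit G x
  /-- `q` is `C^∞`. -/
  contMDiff : ContMDiff (𝓡 4) (𝓡 4) ∞ q
  /-- Only strata of codimension `0, 2, 3, 4` occur (no reflections). -/
  singularCodim_mem : ∀ x : N, singularCodim (𝓡 4) G x ∈ ({0, 2, 3, 4} : Set ℕ)
  /-- `Σ₀`: at a regular point `q` is a local diffeomorphism. -/
  isLocalDiffeomorphAt : ∀ x : N, singularCodim (𝓡 4) G x = 0 →
    IsLocalDiffeomorphAt (𝓡 4) (𝓡 4) ∞ q x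
  /-- `Σ₂`: Hambleton–Hausmann fold charts `(z, w) ↦ (z, wⁿ)`, `n ≥ 2`. -/
  exists_fold_charts : ∀ x : N, singularCodim (𝓡 4) G x = 2 →
    ∃ n : ℕ, 2 ≤ n ∧ ∃ φ ∈ IsManifold.maximalAtlas (𝓡 4) ∞ N,
      ∃ ψ ∈ IsManifold.maximalAtlas (𝓡 4) ∞ M, x ∈ φ.source ∧
        ∀ y ∈ φ.source, q y ∈ ψ.source ∧ ψ (q y) = rotationFoldModel n (φ y)
  /-- `Σ₃`: the fixed line times the cone on the smoothed link `|S²/ρ(G_x)|`: in a linearising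
  chart centred at `x`, `q` preserves the axial coordinate and maps round normal `2`-spheres
  onto round normal `2`-spheres. -/
  exists_lineCone_charts : ∀ x : N, singularCodim (𝓡 4) G x = 3 →
    ∃ φ ∈ IsManifold.maximalAtlas (𝓡 4) ∞ N, ∃ ψ ∈ IsManifold.maximalAtlas (𝓡 4) ∞ M,
      ∃ σ : ℝ → ℝ, x ∈ φ.source ∧ φ x = 0 ∧ q '' φ.source = ψ.source ∧
        StrictMonoOn σ (Ici 0) ∧ σ 0 = 0 ∧
        (∀ g ∈ MulAction.stabilizer G x,
          ∃ A : EuclideanSpace ℝ (Fin 4) ≃ₗᵢ[ℝ] EuclideanSpace ℝ (Fin 4),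
            ∀ y ∈ φ.source, g • y ∈ φ.source ∧ φ (g • y) = A (φ y)) ∧
        ∀ y ∈ φ.source, ψ (q y) 0 = φ y 0 ∧
          ‖axisNormalPart (ψ (q y))‖ = σ ‖axisNormalPart (φ y)‖
  /-- `Σ₄`: the cone on the smoothed link `|S³/ρ(G_x)| ≅ S³`: in a linearising chart centred at
  `x`, `q` maps the round `3`-sphere of radius `t` about `x` onto the round `3`-sphere of radius
  `σ t` about `q x`. -/
  exists_cone_charts : ∀ x : N, singularCodim (𝓡 4) G x = 4 →
    ∃ φ ∈ IsManifold.maximalAtlas (𝓡 4) ∞ N, ∃ ψ ∈ IsManifold.maximalAtlas (𝓡 4) ∞ M,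
      ∃ σ : ℝ → ℝ, x ∈ φ.source ∧ φ x = 0 ∧ q '' φ.source = ψ.source ∧
        StrictMonoOn σ (Ici 0) ∧ σ 0 = 0 ∧
        (∀ g ∈ MulAction.stabilizer G x,
          ∃ A : EuclideanSpace ℝ (Fin 4) ≃ₗᵢ[ℝ] EuclideanSpace ℝ (Fin 4),
            ∀ y ∈ φ.source, g • y ∈ φ.source ∧ φ (g • y) = A (φ y)) ∧
        ∀ y ∈ φ.source, ‖ψ (q y)‖ = σ ‖φ y‖

end Quotient

/-! ### Consequences -/

namespace IsRotationalBranchedQuotient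

variable {G : Type*} [Group G]
  {N : Type*} [TopologicalSpace N] [ChartedSpace (EuclideanSpace ℝ (Fin 4)) N] [MulAction G N]
  {M : Type*} [TopologicalSpace M] [ChartedSpace (EuclideanSpace ℝ (Fin 4)) M]
  {q : N → M}

/-- `q` is constant on orbits: `q (g • x) = q x`. [folklore] -/
theorem apply_smul (h : IsRotationalBranchedQuotient G q) (g : G) (x : N) : q (g • x) = q x :=
  ((h.apply_eq_iff x (g • x)).2 (MulAction.mem_orbit x g)).symm

/-- `q` is surjective (a quotient map). [folklore] -/
theorem surjective (h : IsRotationalBranchedQuotient G q) : Surjective q :=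
  h.isQuotientMap.surjective

/-- `q` is continuous. [folklore] -/
theorem continuous (h : IsRotationalBranchedQuotient G q) : Continuous q :=
  h.isQuotientMap.continuous

/-- The fibre of `q` through `x` is the orbit `G · x`. [folklore] -/
theorem preimage_singleton (h : IsRotationalBranchedQuotient G q) (x : N) :
    q ⁻¹' {q x} = MulAction.orbit G x := by
  ext y
  rw [mem_preimage, mem_singleton_iff, eq_comm]
  exact h.apply_eq_iff x y

/-- The saturation of a set is the union of its translates: `q ⁻¹' (q '' U) = ⋃ g, g • U`.
[folklore] -/
theorem preimage_image_eq (h : IsRotationalBranchedQuotient G q) (U : Set N) :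
    q ⁻¹' (q '' U) = ⋃ g : G, (fun y : N => g • y) '' U := by
  ext y
  simp only [mem_preimage, mem_image, mem_iUnion]
  constructor
  · rintro ⟨x, hxU, hxy⟩
    obtain ⟨g, rfl⟩ := MulAction.mem_orbit_iff.1 ((h.apply_eq_iff x y).1 hxy)
    exact ⟨g, x, hxU, rfl⟩
  · rintro ⟨g, x, hxU, rfl⟩
    exact ⟨x, hxU, (h.apply_smul g x).symm⟩

/-- **`q` is an open map**: the saturation `⋃ g, g • U` of an open set is open, each `g` acting by
a homeomorphism (a `C^∞` map with `C^∞` inverse `g⁻¹`), and `q` is a quotient map. [folklore] -/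
theorem isOpenMap (h : IsRotationalBranchedQuotient G q) : IsOpenMap q := by
  intro U hU
  rw [← h.isQuotientMap.isOpen_preimage, h.preimage_image_eq U]
  refine isOpen_iUnion fun g => ?_
  -- `g • U` is the preimage of `U` under the continuous map `g⁻¹ • ·`
  have hcont : _root_.Continuous fun y : N => g⁻¹ • y :=
    (h.isRotationalAction.contMDiff_smul g⁻¹).continuous
  have : (fun y : N => g • y) '' U = (fun y : N => g⁻¹ • y) ⁻¹' U := by
    ext y
    simp only [mem_image, mem_preimage]
    constructor
    · rintro ⟨x, hx, rfl⟩
      simpa [inv_smul_smul] using hx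
    · intro hy
      exact ⟨g⁻¹ • y, hy, by simp [smul_inv_smul]⟩
  rw [this]
  exact hU.preimage hcont

omit [ChartedSpace (EuclideanSpace ℝ (Fin 4)) N] [ChartedSpace (EuclideanSpace ℝ (Fin 4)) M] in
/-- At a cone point the chart `ψ` is centred: `ψ (q x) = 0` (from `φ x = 0`, `σ 0 = 0`).
[folklore] -/
theorem cone_chart_centred {x : N} {φ : OpenPartialHomeomorph N (EuclideanSpace ℝ (Fin 4))}
    {ψ : OpenPartialHomeomorph M (EuclideanSpace ℝ (Fin 4))} {σ : ℝ → ℝ}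
    (hx : x ∈ φ.source) (hφ : φ x = 0) (hσ : σ 0 = 0)
    (hnorm : ∀ y ∈ φ.source, ‖ψ (q y)‖ = σ ‖φ y‖) : ψ (q x) = 0 := by
  have := hnorm x hx
  rw [hφ, norm_zero, hσ] at this
  exact norm_eq_zero.1 this

omit [ChartedSpace (EuclideanSpace ℝ (Fin 4)) N] [ChartedSpace (EuclideanSpace ℝ (Fin 4)) M] in
/-- At a point of the codimension-`3` stratum the chart `ψ` is centred: `ψ (q x) = 0`.
[folklore] -/
theorem lineCone_chart_centred {x : N} {φ : OpenPartialHomeomorph N (EuclideanSpace ℝ (Fin 4))}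
    {ψ : OpenPartialHomeomorph M (EuclideanSpace ℝ (Fin 4))} {σ : ℝ → ℝ}
    (hx : x ∈ φ.source) (hφ : φ x = 0) (hσ : σ 0 = 0)
    (hmodel : ∀ y ∈ φ.source, ψ (q y) 0 = φ y 0 ∧
      ‖axisNormalPart (ψ (q y))‖ = σ ‖axisNormalPart (φ y)‖) : ψ (q x) = 0 := by
  obtain ⟨h0, hn⟩ := hmodel x hx
  rw [hφ] at h0 hn
  rw [axisNormalPart_zero, norm_zero, hσ, norm_eq_zero] at hn
  ext j
  by_cases hj : j = 0
  · subst hj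
    simpa using h0
  · have := congrArg (fun v : EuclideanSpace ℝ (Fin 4) => v j) hn
    simpa [axisNormalPart_apply, hj] using this

end IsRotationalBranchedQuotient

/-! ### The bundled form: the underlying smooth `4`-manifold `|N/G|` -/

/-- **A rotational quotient of `N` by `G`** ("the underlying SMOOTH `4`-manifold `|N/G|`";
request (b), bundled like `HomotopySphere`): a Hausdorff, second-countable `C^∞` `4`-manifold
`carrier` together with a map `proj : N → carrier` exhibiting it as the rotational branched
quotient of `N` by the given action (`IsRotationalBranchedQuotient`): the covering charts on the
regular part, Hambleton–Hausmann's branched charts along the codimension-`2` strata and the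
cone-off smoothing at the codimension-`3` and `-4` strata. For `N = S⁴` (the route's case) these
are the smooth `4`-manifolds `|S⁴/G|` of finite group actions with rotation-group isotropy
(Lange: exactly the actions whose orbit space is a topological manifold). Existence for every
rotational action and uniqueness up to diffeomorphism are theorems about this structure
(HH Lemma 7.3, Cerf), not part of it. [cite: HambletonHausmann2010, Lemma 7.3 (the quotient smooth structure, unique up to diffeomorphism)] -/
structure RotationalQuotientFour (G : Type*) [Group G] (N : Type*) [TopologicalSpace N]
    [ChartedSpace (EuclideanSpace ℝ (Fin 4)) N] [MulAction G N] where
  /-- The underlying manifold `|N/G|`. -/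
  carrier : Type
  /-- The topology of `|N/G|`. -/
  [topologicalSpace : TopologicalSpace carrier]
  /-- `|N/G|` is Hausdorff. -/
  [t2Space : T2Space carrier]
  /-- `|N/G|` is second countable. -/
  [secondCountableTopology : SecondCountableTopology carrier]
  /-- The atlas of `|N/G|`, modelled on `ℝ⁴`. -/
  [chartedSpace : ChartedSpace (EuclideanSpace ℝ (Fin 4)) carrier]
  /-- `|N/G|` is a `C^∞` manifold. -/
  [isManifold : IsManifold (𝓡 4) ∞ carrier]
  /-- The orbit map `N → |N/G|`. -/
  proj : N → carrier
  /-- `proj` exhibits `carrier` as the rotational branched quotient of `N` by `G`. -/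
  isRotationalBranchedQuotient : IsRotationalBranchedQuotient G proj

attribute [instance] RotationalQuotientFour.topologicalSpace RotationalQuotientFour.t2Space
  RotationalQuotientFour.secondCountableTopology RotationalQuotientFour.chartedSpace
  RotationalQuotientFour.isManifold

namespace RotationalQuotientFour

variable {G : Type*} [Group G] {N : Type*} [TopologicalSpace N]
  [ChartedSpace (EuclideanSpace ℝ (Fin 4)) N] [MulAction G N]

/-- The orbit map of a rotational quotient is surjective. [folklore] -/
theorem proj_surjective (Q : RotationalQuotientFour G N) : Surjective Q.proj :=
  Q.isRotationalBranchedQuotient.surjective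

/-- The orbit map of a rotational quotient is `C^∞`. [folklore] -/
theorem contMDiff_proj (Q : RotationalQuotientFour G N) : ContMDiff (𝓡 4) (𝓡 4) ∞ Q.proj :=
  Q.isRotationalBranchedQuotient.contMDiff

/-- A rotational quotient of a compact manifold is compact (continuous image). [folklore] -/
theorem compactSpace [CompactSpace N] (Q : RotationalQuotientFour G N) : CompactSpace Q.carrier :=
  Q.isRotationalBranchedQuotient.surjective.compactSpace
    Q.isRotationalBranchedQuotient.continuous

end RotationalQuotientFour

end Literature.Topology.FourManifolds

end
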